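import Summits.QuantumFields.YangMills.Theorems.BalabanUVNodesN15KingModelThm33AtRegularFieldRegionDatumAlong

/-!
# Route «BalabanUVNodes», node N15 = NE2 — THE KING-MODEL RUNG, PART Θ⁺⁺⁺-b: KING 1986 THEOREM 3.3 — THE LIVE `δ`-CLAUSES **NEAR THE BOUNDARY**
# (within `R₀` of `∂Ω`, where [Ba1] (2.26) is not available in the tree) FROM THE TRIANGLE `δG_k(Ω, A) = G_k(Ω, A) − G_k(A)` — the boundary
# weight `exp[−δ₀ dist(x, ∂Ω) − δ₀ dist(supp f, ∂Ω)]` is then a bounded factor; general region `Ω`, general fine carrier `V`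

Cell `pub-ymgap`, Track A (D-0062), seat `pub-ymgap-dag-n15-e` (R141 (C), s3), generation 21; sequel of PARTS Θ⁺⁺ ∕ Θ⁺⁺⁺-a.
`bears_on: R4∕N15`; `--supports stmt-QuantumFields-27366` (K3⁸, `--as helper`).  COUNT-NEUTRAL.  Namespace `…N15KingModelRung.Curved`.

THE POINT (elementary, recorded because the assembly PART Θ⁺⁺⁺-c needs it by name).  King's `δ`-clauses carry the extra factor
`exp[−δ₀ dist({x,y}, ∂Ω) − δ₀ dist(supp f, ∂Ω)]`.  At a point `x` with `dist(x, ∂Ω) ≤ R` this factor is harmless: `dist(supp f, ∂Ω) ≤ dist(x, supp f) +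
dist(x, ∂Ω)` (`sbdistI_le_sdistI_add_bdistΩ`), so `e^{−r·dist(x,supp f)} ≤ e^{rR}·e^{−(r∕2)dist(x,supp f)}·e^{−(r∕2)dist(x,∂Ω) − (r∕2)dist(supp f,∂Ω)}`
(`exp_near_boundary`), and `‖δG_k(Ω,A)f(x)‖ ≤ ‖G_k(Ω,A)f(x)‖ + ‖G_k(A)f(x)‖`.  Hence the (3.7)-type bounds for `G_k(Ω, A)` and `G_k(A)` AT `x` give the
`δ`-clauses AT `x` with `(C, δ₀) ↦ ((C_Ω + C_T)e^{δ₀R}, δ₀∕2)`; likewise for `D^η_{A,μ}δG_k` and, for pairs within one unit of each other, for the Hölder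
quotient (`dist(y, ∂Ω) ≤ dist(x, ∂Ω) + |x − y|`); pairs one unit or more apart need no Hölder input (`|x−y|^{−α} ≤ 1`, `U(A(Γ))` isometric).

WHAT THIS FILE PROVES (0 `sorry`, no `def`; everything for a GENERAL region `Ω`, GENERAL fine carrier `V`, the datum `kingThm33DataAlong` of PART Θ⁺⁺-a′ (any contour system `Γ`)).
* §1 distances: `sdistI_le_sdistI_add_tdist`, `bdistΩ_le_bdistΩ_add_tdist`, `sbdistI_le_sdistI_add_bdistΩ` (triangle inequalities of `dist(x, supp f)`,
  `dist(x, Ωᶜ)`, `dist(supp f, Ωᶜ)`), `bdistΩ_le_intRad_of_not_mem` (a point outside the `R₀`-interior is within `R₀` of `Ωᶜ`), `intRad_le`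
  (`R₀ ≤ (2d+7)·K₀·L^k`); weights `exp_near_boundary`, `delta_weight_mono`; `deltaG_eq_sub`, `deltaDG_eq_sub` (`δG = G(Ω) − G(T)` in the datum).
* §2 ★★ `deltaG_near`, `deltaDG_near` — the value ∕ derivative `δ`-clauses AT a point within `R·L^k` of `Ωᶜ` from (3.7)-type bounds for `G_k(Ω,A)`,
  `G_k(A)` at that point; ★★ `deltaHolder_far` — the Hölder `δ`-clause at a pair `≥ L^k` apart from the derivative `δ`-clauses at the two points;
  ★★ `deltaHolder_near` — the Hölder `δ`-clause at a pair `≤ L^k` apart with one point within `R·L^k` of `Ωᶜ`, from the (3.8)-type bounds for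
  `G_k(Ω,A)` and `G_k(A)` at that pair.  [cite: King1986, Thm 3.3 p.656] [cite: Balaban1982Higgs1, Prop. 2.1 (2.26) p.610]

HONEST FRAMING ∕ SCOPE.  Elementary bookkeeping (triangle inequalities and `e^{a}e^{b} = e^{a+b}`); no estimate of [Ba1]∕[Ba4] is touched; the price is
the constant `e^{δ₀R}` with `R = R₀∕L^k ≤ (2d+7)K₀` (per cube size, as all constants of the rung) and the rate `δ₀∕2`.  NOT Bałaban's non-abelian
`G(U)`; NE2⁺ NOT printed ∕ not proved; NOT a node discharge; counts untouched; nothing continuum ∕ ℝ⁴ ∕ OS ∕ mass-gap ∕ Clay.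
-/

noncomputable section

open scoped BigOperators

namespace Summit.QuantumFields.YangMills.BalabanUVNodes.N15KingModelRung.Curved

open Literature.MathematicalPhysics.QuantumFieldTheory.Balaban1983to89
open Literature.MathematicalPhysics.QuantumFieldTheory.Balaban1983to89.HiggsLattice (ChargeData covDeriv)
open Literature.MathematicalPhysics.QuantumFieldTheory.Balaban1983to89.HiggsCovariance (propagatorK)
open Literature.MathematicalPhysics.QuantumFieldTheory.Balaban1983to89.B1TorusChainTransport (hol norm_hol_apply)
open Literature.MathematicalPhysics.QuantumFieldTheory.Balaban1983to89.B1TorusCubeCover (half)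
open Literature.MathematicalPhysics.QuantumFieldTheory.Balaban1983to89.B1TorusCubeLocality26 (rS)
open Literature.MathematicalPhysics.QuantumFieldTheory.Balaban1983to89.B1TorusRegionRop (chi)
open Literature.MathematicalPhysics.QuantumFieldTheory.Balaban1983to89.B1Ineq234LevelZero (tdist_triangle_real)
open Literature.MathematicalPhysics.QuantumFieldTheory.Balaban1983to89.B1Ineq226RegularRegion (covDeriv_sub')
open Literature.MathematicalPhysics.QuantumFieldTheory.King1986.ContinuumLimit (Thm33Data)

variable {N : ℕ} {P : HiggsLattice.Params}

/-! ## §1 Distances and weights -/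

/-- `dist(x, supp f) ≤ dist(y, supp f) + |x − y|`. [cite: King1986, Thm 3.3 (3.7) p.656] -/
theorem sdistI_le_sdistI_add_tdist {V : Finset (HiggsLattice.Site P 0)} (f : VSite V → EuclideanSpace ℝ (Fin N)) (x y : VSite V) :
    sdistI x f ≤ sdistI y f + (HiggsLattice.Site.tdist x.1 y.1 : ℝ) := by
  classical
  by_cases h : (Finset.univ.filter fun z : VSite V => f z ≠ 0).Nonempty
  · obtain ⟨z₀, hz₀, he⟩ := Finset.exists_mem_eq_inf' h fun z => HiggsLattice.Site.tdist y.1 z.1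
    have hfz : f z₀ ≠ 0 := (Finset.mem_filter.1 hz₀).2
    have hy : sdistI y f = (HiggsLattice.Site.tdist y.1 z₀.1 : ℝ) := by
      unfold sdistI; rw [dif_pos h, he]
    calc sdistI x f ≤ (HiggsLattice.Site.tdist x.1 z₀.1 : ℝ) := sdistI_le hfz
      _ ≤ (HiggsLattice.Site.tdist x.1 y.1 : ℝ) + (HiggsLattice.Site.tdist y.1 z₀.1 : ℝ) := tdist_triangle_real _ _ _
      _ = sdistI y f + (HiggsLattice.Site.tdist x.1 y.1 : ℝ) := by rw [hy, add_comm]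
  · have hx : sdistI x f = 0 := by unfold sdistI; rw [dif_neg h]
    rw [hx]
    exact add_nonneg (sdistI_nonneg y f) (Nat.cast_nonneg _)

/-- `dist(y, Ωᶜ) ≤ dist(x, Ωᶜ) + |x − y|`. [cite: King1986, Thm 3.3 p.656] -/
theorem bdistΩ_le_bdistΩ_add_tdist (Ω : Finset (HiggsLattice.Site P 0)) (x y : HiggsLattice.Site P 0) :
    bdistΩ Ω y ≤ bdistΩ Ω x + (HiggsLattice.Site.tdist x y : ℝ) := by
  classical
  by_cases h : (Ωᶜ).Nonempty
  · obtain ⟨w₀, hw₀, he⟩ := Finset.exists_mem_eq_inf' h fun w => HiggsLattice.Site.tdist x w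
    have hw : w₀ ∉ Ω := Finset.mem_compl.1 hw₀
    have hx : bdistΩ Ω x = (HiggsLattice.Site.tdist x w₀ : ℝ) := by unfold bdistΩ; rw [dif_pos h, he]
    calc bdistΩ Ω y ≤ (HiggsLattice.Site.tdist y w₀ : ℝ) := bdistΩ_le y hw
      _ ≤ (HiggsLattice.Site.tdist y x : ℝ) + (HiggsLattice.Site.tdist x w₀ : ℝ) := tdist_triangle_real _ _ _
      _ = bdistΩ Ω x + (HiggsLattice.Site.tdist x y : ℝ) := by rw [hx, tdist_comm y x, add_comm]
  · have hy : bdistΩ Ω y = 0 := by unfold bdistΩ; rw [dif_neg h]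
    rw [hy]
    exact add_nonneg (bdistΩ_nonneg Ω x) (Nat.cast_nonneg _)

/-- `dist(supp f, Ωᶜ) ≤ dist(x, supp f) + dist(x, Ωᶜ)`. [cite: King1986, Thm 3.3 p.656] -/
theorem sbdistI_le_sdistI_add_bdistΩ (Ω : Finset (HiggsLattice.Site P 0)) {V : Finset (HiggsLattice.Site P 0)}
    (f : VSite V → EuclideanSpace ℝ (Fin N)) (x : VSite V) : sbdistI Ω f ≤ sdistI x f + bdistΩ Ω x.1 := by
  classical
  by_cases h : (Finset.univ.filter fun z : VSite V => f z ≠ 0).Nonempty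
  · obtain ⟨z₀, hz₀, he⟩ := Finset.exists_mem_eq_inf' h fun z => HiggsLattice.Site.tdist x.1 z.1
    have hx : sdistI x f = (HiggsLattice.Site.tdist x.1 z₀.1 : ℝ) := by
      unfold sdistI; rw [dif_pos h, he]
    have h1 : sbdistI Ω f ≤ bdistΩ Ω z₀.1 := by
      unfold sbdistI; rw [dif_pos h]; exact Finset.inf'_le _ hz₀
    calc sbdistI Ω f ≤ bdistΩ Ω z₀.1 := h1
      _ ≤ bdistΩ Ω x.1 + (HiggsLattice.Site.tdist x.1 z₀.1 : ℝ) := bdistΩ_le_bdistΩ_add_tdist Ω x.1 z₀.1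
      _ = sdistI x f + bdistΩ Ω x.1 := by rw [hx, add_comm]
  · have h0 : sbdistI Ω f = 0 := by unfold sbdistI; rw [dif_neg h]
    rw [h0]
    exact add_nonneg (sdistI_nonneg x f) (bdistΩ_nonneg Ω x.1)

/-- A point outside the `R₀`-interior is within `R₀` of `Ωᶜ`. [cite: Balaban1982Higgs1, Prop. 2.1 p.610 «dist(x, Ωᶜ) ≥ R₀»] -/
theorem bdistΩ_le_intRad_of_not_mem {k K₀ : ℕ} {Ω : Finset (HiggsLattice.Site P 0)} {x : HiggsLattice.Site P 0} (hx : x ∉ intSet k K₀ Ω) :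
    bdistΩ Ω x ≤ (intRad P k K₀ : ℝ) := by
  rw [mem_intSet] at hx
  push Not at hx
  obtain ⟨y, hy, hyΩ⟩ := hx
  exact (bdistΩ_le x hyΩ).trans (by exact_mod_cast hy)

/-- `R₀ = 2r_S + 2M(d+1) + 1 ≤ (2d+7)·K₀·L^k` (`r_S ≤ 2M`, `M = L^kK₀ ≥ 1`). [cite: Balaban1983RegularityDecay, (2.19) p.578] -/
theorem intRad_le {k K₀ : ℕ} (hK₀ : 1 ≤ K₀) : (intRad P k K₀ : ℝ) ≤ (2 * (P.d : ℝ) + 7) * K₀ * (P.L : ℝ) ^ k := by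
  have hh : 1 ≤ half P k K₀ := Nat.one_le_iff_ne_zero.2 (Nat.mul_ne_zero (pow_ne_zero _ P.hL.ne') (by omega))
  have hLk : P.L ^ k ≤ half P k K₀ := by unfold half; exact Nat.le_mul_of_pos_right _ hK₀
  have hr : rS P k K₀ ≤ 2 * half P k K₀ := by
    unfold rS
    have : 5 * half P k K₀ / 8 ≤ half P k K₀ := Nat.div_le_of_le_mul (by omega)
    omega
  have hn : intRad P k K₀ ≤ (2 * P.d + 7) * half P k K₀ := by
    unfold intRad; nlinarith [hh, hr]
  have hcast : ((2 * P.d + 7) * half P k K₀ : ℕ) = ((2 * (P.d : ℝ) + 7) * K₀ * (P.L : ℝ) ^ k : ℝ) := by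
    unfold half; push_cast; ring
  exact_mod_cast hcast ▸ (show ((intRad P k K₀ : ℕ) : ℝ) ≤ ((2 * P.d + 7) * half P k K₀ : ℕ) by exact_mod_cast hn)

/-- THE NEAR-BOUNDARY WEIGHT: `e^{−rs} ≤ e^{(r∕2)(Q+R)}·e^{−(r∕2)s}·e^{−(r∕2)b − (r∕2)q}` when `q ≤ s + Q`, `b ≤ R`, `r ≥ 0`. [folklore] -/
theorem exp_near_boundary {r s b q Q R : ℝ} (hr : 0 ≤ r) (hq : q ≤ s + Q) (hb : b ≤ R) :
    Real.exp (-(r * s)) ≤ Real.exp (r / 2 * (Q + R)) * (Real.exp (-(r / 2 * s)) * Real.exp (-(r / 2 * b) - r / 2 * q)) := by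
  rw [← Real.exp_add, ← Real.exp_add]
  apply Real.exp_le_exp.2
  have h1 : r / 2 * q ≤ r / 2 * (s + Q) := mul_le_mul_of_nonneg_left hq (by linarith)
  have h2 : r / 2 * b ≤ r / 2 * R := mul_le_mul_of_nonneg_left hb (by linarith)
  nlinarith only [h1, h2]

/-- monotonicity of the `δ`-clause right side in `(C, δ₀)`. [folklore] -/
theorem delta_weight_mono {c c' δ δ' s M b q : ℝ} (hc : c ≤ c') (hc' : 0 ≤ c') (hδ : δ' ≤ δ) (hs : 0 ≤ s) (hM : 0 ≤ M) (hb : 0 ≤ b) (hq : 0 ≤ q) :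
    c * Real.exp (-(δ * s)) * M * Real.exp (-(δ * b) - δ * q) ≤ c' * Real.exp (-(δ' * s)) * M * Real.exp (-(δ' * b) - δ' * q) := by
  have h1 := weight_mono_region hc hc' hδ hs hM
  have h2 : Real.exp (-(δ * b) - δ * q) ≤ Real.exp (-(δ' * b) - δ' * q) :=
    Real.exp_le_exp.2 (by nlinarith only [mul_le_mul_of_nonneg_right hδ hb, mul_le_mul_of_nonneg_right hδ hq])
  exact mul_le_mul h1 h2 (Real.exp_nonneg _) (mul_nonneg (mul_nonneg hc' (Real.exp_nonneg _)) hM)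

section Datum

variable (C : ChargeData N) (k : ℕ) (Ω V : Finset (HiggsLattice.Site P 0)) (Γ : HiggsLattice.Site P 0 → HiggsLattice.Site P 0 → List (HiggsLattice.Site P 0))
  (A : HiggsLattice.VecField P 0) (a msq : ℝ)

/-- `δG_k(Ω, A)f(x) = G_k(Ω, A)f(x) − G_k(A)f(x)` in the datum (same fine carrier on `Ω` and on `T_ε`). [cite: King1986, Thm 3.3 p.656] -/
theorem deltaG_eq_sub (f : VSite V → EuclideanSpace ℝ (Fin N)) (x : VSite V) :
    (kingThm33DataAlong C P k Ω V Γ A a msq).δG f x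
      = (kingThm33DataAlong C P k Ω V Γ A a msq).G f x - (kingThm33DataAlong C P k Finset.univ V Γ A a msq).G f x := by
  show (P.mesh k ^ 2)⁻¹ • (propagatorK C Ω A msq a k (chi Ω • extI f)
      - propagatorK C Finset.univ A msq a k (chi (Finset.univ : Finset (HiggsLattice.Site P 0)) • extI f)) x.1 = _
  rw [Pi.sub_apply, smul_sub]
  rfl

/-- `D^η_{A,μ}δG_k(Ω, A)f(x) = D^η_{A,μ}G_k(Ω, A)f(x) − D^η_{A,μ}G_k(A)f(x)` in the datum. [cite: King1986, Thm 3.3 p.656] -/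
theorem deltaDG_eq_sub (μ : Fin P.d) (f : VSite V → EuclideanSpace ℝ (Fin N)) (x : VSite V) :
    (kingThm33DataAlong C P k Ω V Γ A a msq).δDG μ f x
      = (kingThm33DataAlong C P k Ω V Γ A a msq).DG μ f x - (kingThm33DataAlong C P k Finset.univ V Γ A a msq).DG μ f x := by
  show (P.mesh k)⁻¹ • covDeriv C A (propagatorK C Ω A msq a k (chi Ω • extI f)
      - propagatorK C Finset.univ A msq a k (chi (Finset.univ : Finset (HiggsLattice.Site P 0)) • extI f)) ⟨x.1, μ⟩ = _
  rw [covDeriv_sub', smul_sub]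
  rfl

/-- the datum's `dist(x, supp f) ≥ 0`. [cite: King1986, Thm 3.3 (3.7) p.656] -/
theorem dsupp_nonneg (f : VSite V → EuclideanSpace ℝ (Fin N)) (x : VSite V) : 0 ≤ (kingThm33DataAlong C P k Ω V Γ A a msq).dsupp f x :=
  div_nonneg (sdistI_nonneg x f) (pow_nonneg (Nat.cast_nonneg _) _)

/-- the datum's `dist({x,y}, supp f) ≥ 0`. [cite: King1986, Thm 3.3 (3.8) p.656] -/
theorem dsupp2_nonneg (f : VSite V → EuclideanSpace ℝ (Fin N)) (x y : VSite V) : 0 ≤ (kingThm33DataAlong C P k Ω V Γ A a msq).dsupp2 f x y :=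
  div_nonneg (le_min (sdistI_nonneg x f) (sdistI_nonneg y f)) (pow_nonneg (Nat.cast_nonneg _) _)

/-- the datum's `dist({x,y}, ∂Ω) ≥ 0` on `Ω_η`. [cite: King1986, Thm 3.3 p.656] -/
theorem dbdryη_nonneg (x y : VSite V) : 0 ≤ (kingThm33DataAlong C P k Ω V Γ A a msq).dbdryη x y :=
  div_nonneg (le_min (bdistΩ_nonneg Ω x.1) (bdistΩ_nonneg Ω y.1)) (pow_nonneg (Nat.cast_nonneg _) _)

/-- the datum's `dist(supp f, ∂Ω) ≥ 0`. [cite: King1986, Thm 3.3 p.656] -/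
theorem dsuppbdry_nonneg (f : VSite V → EuclideanSpace ℝ (Fin N)) : 0 ≤ (kingThm33DataAlong C P k Ω V Γ A a msq).dsuppbdry f :=
  div_nonneg (sbdistI_nonneg Ω f) (pow_nonneg (Nat.cast_nonneg _) _)

/-- the two bookkeeping inequalities at a point within `R·L^k` of `Ωᶜ`: `dsuppbdry f ≤ dsupp f x + R`, `dbdryη x x ≤ R`. [cite: King1986, Thm 3.3 p.656] -/
theorem near_bookkeeping {R : ℝ} (f : VSite V → EuclideanSpace ℝ (Fin N)) (x : VSite V) (hnear : bdistΩ Ω x.1 ≤ R * (P.L : ℝ) ^ k) :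
    (kingThm33DataAlong C P k Ω V Γ A a msq).dsuppbdry f ≤ (kingThm33DataAlong C P k Ω V Γ A a msq).dsupp f x + R ∧
      (kingThm33DataAlong C P k Ω V Γ A a msq).dbdryη x x ≤ R := by
  have hLk : (0 : ℝ) < (P.L : ℝ) ^ k := pow_pos (by exact_mod_cast P.hL) _
  have hR : bdistΩ Ω x.1 / (P.L : ℝ) ^ k ≤ R := by rw [div_le_iff₀ hLk]; exact hnear
  constructor
  · show sbdistI Ω f / (P.L : ℝ) ^ k ≤ sdistI x f / (P.L : ℝ) ^ k + R
    have h1 : sbdistI Ω f / (P.L : ℝ) ^ k ≤ (sdistI x f + bdistΩ Ω x.1) / (P.L : ℝ) ^ k :=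
      div_le_div_of_nonneg_right (sbdistI_le_sdistI_add_bdistΩ Ω f x) hLk.le
    rw [add_div] at h1
    linarith only [h1, hR]
  · show min (bdistΩ Ω x.1) (bdistΩ Ω x.1) / (P.L : ℝ) ^ k ≤ R
    rw [min_self]; exact hR

/-! ## §2 The `δ`-clauses near the boundary and for far-apart pairs -/

/-- ★★ THE VALUE `δ`-CLAUSE AT A POINT WITHIN `R·L^k` OF `Ωᶜ` from (3.7)-type bounds for `G_k(Ω, A)` and `G_k(A)` at that point.
[cite: King1986, Thm 3.3 (3.7) p.656] [cite: Balaban1982Higgs1, Prop. 2.1 (2.26) p.610] -/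
theorem deltaG_near {Cc CT r R : ℝ} (hCc : 0 ≤ Cc) (hCT : 0 ≤ CT) (hr : 0 ≤ r) (f : VSite V → EuclideanSpace ℝ (Fin N)) (x : VSite V)
    (hG : ‖(kingThm33DataAlong C P k Ω V Γ A a msq).G f x‖
      ≤ Cc * Real.exp (-(r * (kingThm33DataAlong C P k Ω V Γ A a msq).dsupp f x)) * ‖f‖)
    (hGT : ‖(kingThm33DataAlong C P k Finset.univ V Γ A a msq).G f x‖
      ≤ CT * Real.exp (-(r * (kingThm33DataAlong C P k Ω V Γ A a msq).dsupp f x)) * ‖f‖)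
    (hnear : bdistΩ Ω x.1 ≤ R * (P.L : ℝ) ^ k) :
    ‖(kingThm33DataAlong C P k Ω V Γ A a msq).δG f x‖
      ≤ (Cc + CT) * Real.exp (r * R) * Real.exp (-(r / 2 * (kingThm33DataAlong C P k Ω V Γ A a msq).dsupp f x)) * ‖f‖
        * Real.exp (-(r / 2 * (kingThm33DataAlong C P k Ω V Γ A a msq).dbdryη x x) - r / 2 * (kingThm33DataAlong C P k Ω V Γ A a msq).dsuppbdry f) := by
  obtain ⟨hq, hb⟩ := near_bookkeeping C k Ω V Γ A a msq f x hnear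
  have hw := exp_near_boundary (s := (kingThm33DataAlong C P k Ω V Γ A a msq).dsupp f x) hr hq hb
  have hRR : r / 2 * (R + R) = r * R := by ring
  rw [hRR] at hw
  rw [deltaG_eq_sub]
  calc ‖(kingThm33DataAlong C P k Ω V Γ A a msq).G f x - (kingThm33DataAlong C P k Finset.univ V Γ A a msq).G f x‖
      ≤ Cc * Real.exp (-(r * (kingThm33DataAlong C P k Ω V Γ A a msq).dsupp f x)) * ‖f‖
        + CT * Real.exp (-(r * (kingThm33DataAlong C P k Ω V Γ A a msq).dsupp f x)) * ‖f‖ := (norm_sub_le _ _).trans (add_le_add hG hGT)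
    _ = (Cc + CT) * ‖f‖ * Real.exp (-(r * (kingThm33DataAlong C P k Ω V Γ A a msq).dsupp f x)) := by ring
    _ ≤ (Cc + CT) * ‖f‖ * (Real.exp (r * R) * (Real.exp (-(r / 2 * (kingThm33DataAlong C P k Ω V Γ A a msq).dsupp f x))
        * Real.exp (-(r / 2 * (kingThm33DataAlong C P k Ω V Γ A a msq).dbdryη x x) - r / 2 * (kingThm33DataAlong C P k Ω V Γ A a msq).dsuppbdry f))) :=
        mul_le_mul_of_nonneg_left hw (mul_nonneg (add_nonneg hCc hCT) (norm_nonneg _))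
    _ = _ := by ring

/-- ★★ THE DERIVATIVE `δ`-CLAUSE AT A POINT WITHIN `R·L^k` OF `Ωᶜ` from (3.7)-type bounds for `D^η_{A,μ}G_k(Ω, A)` and `D^η_{A,μ}G_k(A)` at that point.
[cite: King1986, Thm 3.3 (3.7) p.656] [cite: Balaban1982Higgs1, Prop. 2.1 (2.26) p.610] -/
theorem deltaDG_near {Cc CT r R : ℝ} (hCc : 0 ≤ Cc) (hCT : 0 ≤ CT) (hr : 0 ≤ r) (μ : Fin P.d) (f : VSite V → EuclideanSpace ℝ (Fin N)) (x : VSite V)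
    (hG : ‖(kingThm33DataAlong C P k Ω V Γ A a msq).DG μ f x‖
      ≤ Cc * Real.exp (-(r * (kingThm33DataAlong C P k Ω V Γ A a msq).dsupp f x)) * ‖f‖)
    (hGT : ‖(kingThm33DataAlong C P k Finset.univ V Γ A a msq).DG μ f x‖
      ≤ CT * Real.exp (-(r * (kingThm33DataAlong C P k Ω V Γ A a msq).dsupp f x)) * ‖f‖)
    (hnear : bdistΩ Ω x.1 ≤ R * (P.L : ℝ) ^ k) :
    ‖(kingThm33DataAlong C P k Ω V Γ A a msq).δDG μ f x‖
      ≤ (Cc + CT) * Real.exp (r * R) * Real.exp (-(r / 2 * (kingThm33DataAlong C P k Ω V Γ A a msq).dsupp f x)) * ‖f‖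
        * Real.exp (-(r / 2 * (kingThm33DataAlong C P k Ω V Γ A a msq).dbdryη x x) - r / 2 * (kingThm33DataAlong C P k Ω V Γ A a msq).dsuppbdry f) := by
  obtain ⟨hq, hb⟩ := near_bookkeeping C k Ω V Γ A a msq f x hnear
  have hw := exp_near_boundary (s := (kingThm33DataAlong C P k Ω V Γ A a msq).dsupp f x) hr hq hb
  have hRR : r / 2 * (R + R) = r * R := by ring
  rw [hRR] at hw
  rw [deltaDG_eq_sub]
  calc ‖(kingThm33DataAlong C P k Ω V Γ A a msq).DG μ f x - (kingThm33DataAlong C P k Finset.univ V Γ A a msq).DG μ f x‖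
      ≤ Cc * Real.exp (-(r * (kingThm33DataAlong C P k Ω V Γ A a msq).dsupp f x)) * ‖f‖
        + CT * Real.exp (-(r * (kingThm33DataAlong C P k Ω V Γ A a msq).dsupp f x)) * ‖f‖ := (norm_sub_le _ _).trans (add_le_add hG hGT)
    _ = (Cc + CT) * ‖f‖ * Real.exp (-(r * (kingThm33DataAlong C P k Ω V Γ A a msq).dsupp f x)) := by ring
    _ ≤ (Cc + CT) * ‖f‖ * (Real.exp (r * R) * (Real.exp (-(r / 2 * (kingThm33DataAlong C P k Ω V Γ A a msq).dsupp f x))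
        * Real.exp (-(r / 2 * (kingThm33DataAlong C P k Ω V Γ A a msq).dbdryη x x) - r / 2 * (kingThm33DataAlong C P k Ω V Γ A a msq).dsuppbdry f))) :=
        mul_le_mul_of_nonneg_left hw (mul_nonneg (add_nonneg hCc hCT) (norm_nonneg _))
    _ = _ := by ring

/-- ★★ THE HÖLDER `δ`-CLAUSE AT A PAIR `≥ L^k` APART (`|x − y| ≥ 1` in `η`-units: the factor `|x−y|^{−α} ≤ 1`, `U(A(Γ_{y,x}))` is isometric) from the
derivative `δ`-clauses at the two points. [cite: King1986, Thm 3.3 (3.8) p.656] [cite: Balaban1983RegularityDecay, p.578 «If |x′ − x| > 1 …»] -/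
theorem deltaHolder_far {Cc δ₀ : ℝ} (hCc : 0 ≤ Cc) (hδ : 0 ≤ δ₀) (μ : Fin P.d) (f : VSite V → EuclideanSpace ℝ (Fin N)) (x y : VSite V)
    (hfar : (P.L : ℝ) ^ k ≤ (HiggsLattice.Site.tdist x.1 y.1 : ℝ))
    (hx : ‖(kingThm33DataAlong C P k Ω V Γ A a msq).δDG μ f x‖
      ≤ Cc * Real.exp (-(δ₀ * (kingThm33DataAlong C P k Ω V Γ A a msq).dsupp f x)) * ‖f‖
        * Real.exp (-(δ₀ * (kingThm33DataAlong C P k Ω V Γ A a msq).dbdryη x x) - δ₀ * (kingThm33DataAlong C P k Ω V Γ A a msq).dsuppbdry f))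
    (hy : ‖(kingThm33DataAlong C P k Ω V Γ A a msq).δDG μ f y‖
      ≤ Cc * Real.exp (-(δ₀ * (kingThm33DataAlong C P k Ω V Γ A a msq).dsupp f y)) * ‖f‖
        * Real.exp (-(δ₀ * (kingThm33DataAlong C P k Ω V Γ A a msq).dbdryη y y) - δ₀ * (kingThm33DataAlong C P k Ω V Γ A a msq).dsuppbdry f)) :
    ((kingThm33DataAlong C P k Ω V Γ A a msq).distη x y) ^ (-(1 / 2 : ℝ)) *
        ‖(kingThm33DataAlong C P k Ω V Γ A a msq).transport y x ((kingThm33DataAlong C P k Ω V Γ A a msq).δDG μ f x)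
          - (kingThm33DataAlong C P k Ω V Γ A a msq).δDG μ f y‖
      ≤ 2 * Cc * Real.exp (-(δ₀ * (kingThm33DataAlong C P k Ω V Γ A a msq).dsupp2 f x y)) * ‖f‖
        * Real.exp (-(δ₀ * (kingThm33DataAlong C P k Ω V Γ A a msq).dbdryη x y) - δ₀ * (kingThm33DataAlong C P k Ω V Γ A a msq).dsuppbdry f) := by
  have hLk : (0 : ℝ) < (P.L : ℝ) ^ k := pow_pos (by exact_mod_cast P.hL) _
  -- the factor `|x − y|^{−½} ≤ 1`
  have hfac : ((kingThm33DataAlong C P k Ω V Γ A a msq).distη x y) ^ (-(1 / 2 : ℝ)) ≤ 1 := by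
    show ((HiggsLattice.Site.tdist x.1 y.1 : ℝ) / (P.L : ℝ) ^ k) ^ (-(1 / 2 : ℝ)) ≤ 1
    exact Real.rpow_le_one_of_one_le_of_nonpos (by rw [le_div_iff₀ hLk, one_mul]; exact hfar) (by norm_num)
  have hfac0 : 0 ≤ ((kingThm33DataAlong C P k Ω V Γ A a msq).distη x y) ^ (-(1 / 2 : ℝ)) := by
    show 0 ≤ ((HiggsLattice.Site.tdist x.1 y.1 : ℝ) / (P.L : ℝ) ^ k) ^ (-(1 / 2 : ℝ))
    exact Real.rpow_nonneg (div_nonneg (Nat.cast_nonneg _) hLk.le) _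
  -- the transport is isometric
  have hT : ‖(kingThm33DataAlong C P k Ω V Γ A a msq).transport y x ((kingThm33DataAlong C P k Ω V Γ A a msq).δDG μ f x)‖
      = ‖(kingThm33DataAlong C P k Ω V Γ A a msq).δDG μ f x‖ := by
    show ‖hol C A y.1 (Γ y.1 x.1) _‖ = _
    exact norm_hol_apply C A y.1 (Γ y.1 x.1) _
  -- monotonicity to the pair data
  have hsx : (kingThm33DataAlong C P k Ω V Γ A a msq).dsupp2 f x y ≤ (kingThm33DataAlong C P k Ω V Γ A a msq).dsupp f x := by
    show min (sdistI x f) (sdistI y f) / (P.L : ℝ) ^ k ≤ sdistI x f / (P.L : ℝ) ^ k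
    exact div_le_div_of_nonneg_right (min_le_left _ _) hLk.le
  have hsy : (kingThm33DataAlong C P k Ω V Γ A a msq).dsupp2 f x y ≤ (kingThm33DataAlong C P k Ω V Γ A a msq).dsupp f y := by
    show min (sdistI x f) (sdistI y f) / (P.L : ℝ) ^ k ≤ sdistI y f / (P.L : ℝ) ^ k
    exact div_le_div_of_nonneg_right (min_le_right _ _) hLk.le
  have hbx : (kingThm33DataAlong C P k Ω V Γ A a msq).dbdryη x y ≤ (kingThm33DataAlong C P k Ω V Γ A a msq).dbdryη x x := by
    show min (bdistΩ Ω x.1) (bdistΩ Ω y.1) / (P.L : ℝ) ^ k ≤ min (bdistΩ Ω x.1) (bdistΩ Ω x.1) / (P.L : ℝ) ^ k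
    rw [min_self]; exact div_le_div_of_nonneg_right (min_le_left _ _) hLk.le
  have hby : (kingThm33DataAlong C P k Ω V Γ A a msq).dbdryη x y ≤ (kingThm33DataAlong C P k Ω V Γ A a msq).dbdryη y y := by
    show min (bdistΩ Ω x.1) (bdistΩ Ω y.1) / (P.L : ℝ) ^ k ≤ min (bdistΩ Ω y.1) (bdistΩ Ω y.1) / (P.L : ℝ) ^ k
    rw [min_self]; exact div_le_div_of_nonneg_right (min_le_right _ _) hLk.le
  have hq0 := dsuppbdry_nonneg C k Ω V Γ A a msq f
  have key : ∀ {s s' b b' : ℝ}, s' ≤ s → b' ≤ b →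
      Cc * Real.exp (-(δ₀ * s)) * ‖f‖ * Real.exp (-(δ₀ * b) - δ₀ * (kingThm33DataAlong C P k Ω V Γ A a msq).dsuppbdry f)
        ≤ Cc * Real.exp (-(δ₀ * s')) * ‖f‖ * Real.exp (-(δ₀ * b') - δ₀ * (kingThm33DataAlong C P k Ω V Γ A a msq).dsuppbdry f) := by
    intro s s' b b' hs hb
    have e1 : Real.exp (-(δ₀ * s)) ≤ Real.exp (-(δ₀ * s')) := Real.exp_le_exp.2 (neg_le_neg (mul_le_mul_of_nonneg_left hs hδ))
    have e2 : Real.exp (-(δ₀ * b) - δ₀ * (kingThm33DataAlong C P k Ω V Γ A a msq).dsuppbdry f)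
        ≤ Real.exp (-(δ₀ * b') - δ₀ * (kingThm33DataAlong C P k Ω V Γ A a msq).dsuppbdry f) :=
      Real.exp_le_exp.2 (by nlinarith only [mul_le_mul_of_nonneg_left hb hδ])
    exact mul_le_mul (mul_le_mul_of_nonneg_right (mul_le_mul_of_nonneg_left e1 hCc) (norm_nonneg _)) e2 (Real.exp_nonneg _)
      (mul_nonneg (mul_nonneg hCc (Real.exp_nonneg _)) (norm_nonneg _))
  have hx' := hx.trans (key hsx hbx)
  have hy' := hy.trans (key hsy hby)
  calc ((kingThm33DataAlong C P k Ω V Γ A a msq).distη x y) ^ (-(1 / 2 : ℝ)) *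
        ‖(kingThm33DataAlong C P k Ω V Γ A a msq).transport y x ((kingThm33DataAlong C P k Ω V Γ A a msq).δDG μ f x)
          - (kingThm33DataAlong C P k Ω V Γ A a msq).δDG μ f y‖
      ≤ 1 * (‖(kingThm33DataAlong C P k Ω V Γ A a msq).transport y x ((kingThm33DataAlong C P k Ω V Γ A a msq).δDG μ f x)‖
          + ‖(kingThm33DataAlong C P k Ω V Γ A a msq).δDG μ f y‖) :=
        mul_le_mul hfac (norm_sub_le _ _) (norm_nonneg _) zero_le_one
    _ = ‖(kingThm33DataAlong C P k Ω V Γ A a msq).δDG μ f x‖ + ‖(kingThm33DataAlong C P k Ω V Γ A a msq).δDG μ f y‖ := by rw [one_mul, hT]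
    _ ≤ _ := (add_le_add hx' hy').trans (le_of_eq (by ring))

/-- ★★ THE HÖLDER `δ`-CLAUSE AT A PAIR `≤ L^k` APART WITH ONE POINT WITHIN `R·L^k` OF `Ωᶜ`, from (3.8)-type bounds for `G_k(Ω, A)` and `G_k(A)` at that
pair (`dist(y, Ωᶜ) ≤ dist(x, Ωᶜ) + |x − y|`, `dist(x, supp f) ≤ dist(y, supp f) + |x − y|`). [cite: King1986, Thm 3.3 (3.8) p.656]
[cite: Balaban1982Higgs1, Prop. 2.1 (2.26) p.610] -/
theorem deltaHolder_near {Cc CT r R : ℝ} (hCc : 0 ≤ Cc) (hCT : 0 ≤ CT) (hr : 0 ≤ r) (hR : 0 ≤ R) (μ : Fin P.d)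
    (f : VSite V → EuclideanSpace ℝ (Fin N)) (x y : VSite V)
    (hclose : (HiggsLattice.Site.tdist x.1 y.1 : ℝ) ≤ (P.L : ℝ) ^ k)
    (hnear : min (bdistΩ Ω x.1) (bdistΩ Ω y.1) ≤ R * (P.L : ℝ) ^ k)
    (hH : ((kingThm33DataAlong C P k Ω V Γ A a msq).distη x y) ^ (-(1 / 2 : ℝ)) *
        ‖(kingThm33DataAlong C P k Ω V Γ A a msq).transport y x ((kingThm33DataAlong C P k Ω V Γ A a msq).DG μ f x)
          - (kingThm33DataAlong C P k Ω V Γ A a msq).DG μ f y‖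
      ≤ Cc * Real.exp (-(r * (kingThm33DataAlong C P k Ω V Γ A a msq).dsupp2 f x y)) * ‖f‖)
    (hHT : ((kingThm33DataAlong C P k Ω V Γ A a msq).distη x y) ^ (-(1 / 2 : ℝ)) *
        ‖(kingThm33DataAlong C P k Ω V Γ A a msq).transport y x ((kingThm33DataAlong C P k Finset.univ V Γ A a msq).DG μ f x)
          - (kingThm33DataAlong C P k Finset.univ V Γ A a msq).DG μ f y‖
      ≤ CT * Real.exp (-(r * (kingThm33DataAlong C P k Ω V Γ A a msq).dsupp2 f x y)) * ‖f‖) :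
    ((kingThm33DataAlong C P k Ω V Γ A a msq).distη x y) ^ (-(1 / 2 : ℝ)) *
        ‖(kingThm33DataAlong C P k Ω V Γ A a msq).transport y x ((kingThm33DataAlong C P k Ω V Γ A a msq).δDG μ f x)
          - (kingThm33DataAlong C P k Ω V Γ A a msq).δDG μ f y‖
      ≤ (Cc + CT) * Real.exp (r / 2 * (3 * R + 2)) * Real.exp (-(r / 2 * (kingThm33DataAlong C P k Ω V Γ A a msq).dsupp2 f x y)) * ‖f‖
        * Real.exp (-(r / 2 * (kingThm33DataAlong C P k Ω V Γ A a msq).dbdryη x y) - r / 2 * (kingThm33DataAlong C P k Ω V Γ A a msq).dsuppbdry f) := by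
  have hLk : (0 : ℝ) < (P.L : ℝ) ^ k := pow_pos (by exact_mod_cast P.hL) _
  have hfac0 : 0 ≤ ((kingThm33DataAlong C P k Ω V Γ A a msq).distη x y) ^ (-(1 / 2 : ℝ)) := by
    show 0 ≤ ((HiggsLattice.Site.tdist x.1 y.1 : ℝ) / (P.L : ℝ) ^ k) ^ (-(1 / 2 : ℝ))
    exact Real.rpow_nonneg (div_nonneg (Nat.cast_nonneg _) hLk.le) _
  -- bookkeeping: `q ≤ s' + (2R + 2)`, `b' ≤ R`
  have hb : (kingThm33DataAlong C P k Ω V Γ A a msq).dbdryη x y ≤ R := by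
    show min (bdistΩ Ω x.1) (bdistΩ Ω y.1) / (P.L : ℝ) ^ k ≤ R
    rw [div_le_iff₀ hLk]; exact hnear
  have hbx : bdistΩ Ω x.1 ≤ (R + 1) * (P.L : ℝ) ^ k := by
    rcases min_choice (bdistΩ Ω x.1) (bdistΩ Ω y.1) with h | h
    · rw [h] at hnear; nlinarith only [hnear, hLk]
    · rw [h] at hnear
      have := bdistΩ_le_bdistΩ_add_tdist Ω y.1 x.1
      rw [tdist_comm y.1 x.1] at this
      nlinarith only [this, hnear, hclose, hLk]
  have hby : bdistΩ Ω y.1 ≤ (R + 1) * (P.L : ℝ) ^ k := by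
    rcases min_choice (bdistΩ Ω x.1) (bdistΩ Ω y.1) with h | h
    · rw [h] at hnear
      have := bdistΩ_le_bdistΩ_add_tdist Ω x.1 y.1
      nlinarith only [this, hnear, hclose, hLk]
    · rw [h] at hnear; nlinarith only [hnear, hLk]
  have hq : (kingThm33DataAlong C P k Ω V Γ A a msq).dsuppbdry f ≤ (kingThm33DataAlong C P k Ω V Γ A a msq).dsupp2 f x y + (2 * R + 2) := by
    show sbdistI Ω f / (P.L : ℝ) ^ k ≤ min (sdistI x f) (sdistI y f) / (P.L : ℝ) ^ k + (2 * R + 2)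
    rw [div_le_iff₀ hLk, add_mul, div_mul_cancel₀ _ hLk.ne']
    rcases min_choice (sdistI x f) (sdistI y f) with h | h
    · rw [h]
      have h1 := sbdistI_le_sdistI_add_bdistΩ Ω f x
      nlinarith only [h1, hbx, hLk, hR]
    · rw [h]
      have h1 := sbdistI_le_sdistI_add_bdistΩ Ω f y
      nlinarith only [h1, hby, hLk, hR]
  have hw := exp_near_boundary (s := (kingThm33DataAlong C P k Ω V Γ A a msq).dsupp2 f x y) hr hq hb
  have hRR : r / 2 * (2 * R + 2 + R) = r / 2 * (3 * R + 2) := by ring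
  rw [hRR] at hw
  -- the split `δDG = DG(Ω) − DG(T)` under the transport
  have hsplit : (kingThm33DataAlong C P k Ω V Γ A a msq).transport y x ((kingThm33DataAlong C P k Ω V Γ A a msq).δDG μ f x)
        - (kingThm33DataAlong C P k Ω V Γ A a msq).δDG μ f y
      = ((kingThm33DataAlong C P k Ω V Γ A a msq).transport y x ((kingThm33DataAlong C P k Ω V Γ A a msq).DG μ f x)
          - (kingThm33DataAlong C P k Ω V Γ A a msq).DG μ f y)
        - ((kingThm33DataAlong C P k Ω V Γ A a msq).transport y x ((kingThm33DataAlong C P k Finset.univ V Γ A a msq).DG μ f x)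
          - (kingThm33DataAlong C P k Finset.univ V Γ A a msq).DG μ f y) := by
    rw [deltaDG_eq_sub, deltaDG_eq_sub, map_sub]; abel
  rw [hsplit]
  calc ((kingThm33DataAlong C P k Ω V Γ A a msq).distη x y) ^ (-(1 / 2 : ℝ)) *
        ‖((kingThm33DataAlong C P k Ω V Γ A a msq).transport y x ((kingThm33DataAlong C P k Ω V Γ A a msq).DG μ f x)
            - (kingThm33DataAlong C P k Ω V Γ A a msq).DG μ f y)
          - ((kingThm33DataAlong C P k Ω V Γ A a msq).transport y x ((kingThm33DataAlong C P k Finset.univ V Γ A a msq).DG μ f x)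
            - (kingThm33DataAlong C P k Finset.univ V Γ A a msq).DG μ f y)‖
      ≤ ((kingThm33DataAlong C P k Ω V Γ A a msq).distη x y) ^ (-(1 / 2 : ℝ)) *
          (‖(kingThm33DataAlong C P k Ω V Γ A a msq).transport y x ((kingThm33DataAlong C P k Ω V Γ A a msq).DG μ f x)
              - (kingThm33DataAlong C P k Ω V Γ A a msq).DG μ f y‖
            + ‖(kingThm33DataAlong C P k Ω V Γ A a msq).transport y x ((kingThm33DataAlong C P k Finset.univ V Γ A a msq).DG μ f x)
              - (kingThm33DataAlong C P k Finset.univ V Γ A a msq).DG μ f y‖) :=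
        mul_le_mul_of_nonneg_left (norm_sub_le _ _) hfac0
    _ ≤ Cc * Real.exp (-(r * (kingThm33DataAlong C P k Ω V Γ A a msq).dsupp2 f x y)) * ‖f‖
          + CT * Real.exp (-(r * (kingThm33DataAlong C P k Ω V Γ A a msq).dsupp2 f x y)) * ‖f‖ := by rw [mul_add]; exact add_le_add hH hHT
    _ = (Cc + CT) * ‖f‖ * Real.exp (-(r * (kingThm33DataAlong C P k Ω V Γ A a msq).dsupp2 f x y)) := by ring
    _ ≤ (Cc + CT) * ‖f‖ * (Real.exp (r / 2 * (3 * R + 2)) * (Real.exp (-(r / 2 * (kingThm33DataAlong C P k Ω V Γ A a msq).dsupp2 f x y))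
        * Real.exp (-(r / 2 * (kingThm33DataAlong C P k Ω V Γ A a msq).dbdryη x y) - r / 2 * (kingThm33DataAlong C P k Ω V Γ A a msq).dsuppbdry f))) :=
        mul_le_mul_of_nonneg_left hw (mul_nonneg (add_nonneg hCc hCT) (norm_nonneg _))
    _ = _ := by ring

end Datum

end Summit.QuantumFields.YangMills.BalabanUVNodes.N15KingModelRung.Curved

end
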